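/-
Copyright: statement-level skeleton of a published paper (lit-balaban cell, Phase-2 proof seat p30, gen 2). No proof
claims beyond what the kernel checks below.
-/
import Mathlib

/-!
# `BalabanImbrieJaffe1984to88.BIJ85AppALemmas` — T. Bałaban, J. Imbrie, A. Jaffe, *Renormalization of the Higgs model:
minimizers, propagators and the stability of mean field theory*, Commun. Math. Phys. **97** (1985) 299–329
[BalabanImbrieJaffe1985]: Appendix "Quadratic Forms" pp. 327–328 — the finite-dimensional GAUSSIAN INTEGRAL with a linear source behind
(A6), (A7), (A15), (A17) (translation to the minimum, oddness of the fluctuation; Lebesgue measure of a finite-dimensional inner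
product space), the unconstrained representation **(A6)** PROVED, and the objects of (A9)–(A12): G = (Δ+V)⁻¹ (A11) and the
(A12)-orthogonal projection P onto ℋ₀ = Null V EXIST and are UNIQUE under (A10)

statement-level skeleton of published theorems with citation tags; proofs where landed; nothing here is a claim about the Yang–Mills mass gap

PDF held: `paper:balaban1985-cmp97-bij-higgs-minimizers` (journal page = PDF page + 298).  Renders read as images: pp. 327–329
(`HOME/lit-balaban-r15/pages/1985-cmp97-bij-higgs-minimizers-p029-x2.png`, `…-p030-x2.png`, `…-p031-x2.png`).

CITATION HEADER (lean-in-tree rule).  Part of the lit-balaban TYPED SKELETON (HOME `run/shared/lean/pub/lit-balaban/`): WHAT IS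
REPRODUCED = the printed mechanism of rows **C1.EqA5-A12** ((A5)–(A6) PROVED as `eqA6`; (A9)–(A12): `a9_of_a10`, `exists_G`,
`exists_P`, `P_unique`) and **C1.PropA3** (proved in the sibling `BIJ85PropA3Proof`, which imports this file) of
`HOME/lit-balaban-r15/ROWS-C1-part2.md`.  Second of three Appendix-A files of seat p30 gen 2; unit `lit-balaban-p30`.

THE PRINTED TEXT (verbatim, pp. 327–328 [PDF 29–30]).  *"We now specialize to the case where ℋ = L₂(ℝ^N, dx), with dx Lebesgue
measure. We consider the Green's function C of Δ. Assuming 0 < Δ, then we have two convenient representations for C. First C = Δ⁻¹,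
(A5) by which we express C as the operator inverse of Δ. Secondly, we can express C as a moment of a Gaussian measure, namely
exp(½⟨B,CB⟩) = Z⁻¹∫_ℋ exp(−½⟨x,Δx⟩ + ⟨x,B⟩)dx. (A6)  We are often interested, however, in the case of operators Δ with zero modes.
Thus Δ has an inverse only when restricted to a subspace ℋ₀ ⊂ ℋ which does not contain zero modes. Likewise an integral such as (A6)
converges only when restricted to such a subspace. … Let us make the following assumptions: Let V be given and I ≤ Δ₀ on ℋ₀, (A9)
I ≤ Δ + V on ℋ, (A10) where ℋ₀ = Null V. With these definitions, define G = (Δ+V)⁻¹ (A11) and let ( , ) be the inner product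
(x,y) ≡ ⟨x,(Δ+V)y⟩. (A12) Then let P denote the projection of ℋ onto ℋ₀, where P is orthogonal in the inner product (A12)."*  And
p. 328–329, the mechanism: *"Thus (A7) can be written exp(½⟨B,CB⟩) = Z⁻¹∫_{ℋ₀} exp(−½⟨x−PGB,(Δ+V)(x−PGB)⟩ + ½⟨PGB,(Δ+V)PGB⟩)dx,
(A17) … Next note that (A17) displays CB as the minimum of ½⟨x,Δx⟩ − ⟨x,B⟩, since linear terms in the fluctuation x − PGB do not
occur. … so the integral in (A15) equals CB."*

THE TYPING.  §1 (the Gaussian mechanism, stated once for any finite-dimensional real inner product space `W` with its Lebesgue =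
`volume` measure (Mathlib `measureSpaceOfInnerProductSpace`), a linear `M : W → W` symmetric (`hM`) and COERCIVE `c‖w‖² ≤ ⟨w,Mw⟩`,
c > 0 (`hcoer` — this is (A9)/(A10), resp. *"0 < Δ"* of (A6) in finite dimension), a source `b` and a point `m` with Mm = b (the
minimum)): `complete_square` (the algebra of (A16)/(A17)), `integrable_gauss` / `integrable_gauss_smul` (convergence), `integral_gauss_eq`
(∫exp(−½⟨w,Mw⟩ + ⟨w,b⟩)dw = exp(½⟨b,m⟩)·Z by TRANSLATION INVARIANCE of Lebesgue measure — the step (A7) ⇒ (A17)), `integral_gauss_pos`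
(Z > 0), `integral_gauss_smul_zero` (ODDNESS: the fluctuation has mean zero, *"so the integral in (A15) equals CB"*),
`integral_gauss_smul_eq` (the Gaussian mean is m); **(A6)** `eqA6` for ℋ₀ = ℋ, C = Δ⁻¹ (`hC` : ΔC = I).  §2 (the objects of
Prop. A3 on a finite-dimensional real inner product space `H` ∋ x with symmetric Δ, V (`hΔ`, `hV`)): `a9_of_a10` (TRANSCRIPT NOTE
T6: (A9) follows from (A10), since on ℋ₀ = Null V the forms of Δ and Δ + V agree; both are kept as printed), `injective_of_a10` /
`exists_G` / `G_left_inv` ((A11): G = (Δ+V)⁻¹ exists, two-sided), and P characterised by its printed definition — `P x ∈ ℋ₀` (`hP0`)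
and `(x − Px, y) = 0 for y ∈ ℋ₀` in the inner product (A12) (`hP`): `P_apply_of_mem` (P = I on ℋ₀), `P_idem`, `P_unique`, `exists_P`
(the compression of Δ + V to ℋ₀ is invertible).  Carrier clauses (F6): none beyond Mathlib; NOTHING of the paper is asserted beyond
the kernel-checked statements below.
-/

open scoped RealInnerProductSpace
open MeasureTheory

namespace Literature.MathematicalPhysics.QuantumFieldTheory.BalabanImbrieJaffe1984to88.BIJ85AppALemmas

/-! ## §1 Gaussian integrals over a finite-dimensional inner product space (the mechanism of (A6), (A7), (A15), (A17)) -/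

section Gaussian

variable {W : Type*} [NormedAddCommGroup W] [InnerProductSpace ℝ W]

variable (M : W →ₗ[ℝ] W) (b : W)

/-- The elementary bound t·s ≤ (c/4)t² + s²/c (c > 0). [cite: BalabanImbrieJaffe1985, (A6) p.327] -/
theorem mul_le_quad {c : ℝ} (hc : 0 < c) (t s : ℝ) : t * s ≤ c / 4 * t ^ 2 + s ^ 2 / c := by
  have key : c / 4 * t ^ 2 + s ^ 2 / c - t * s = c * (t / 2 - s / c) ^ 2 := by
    field_simp
    ring
  nlinarith [key, mul_nonneg hc.le (sq_nonneg (t / 2 - s / c))]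

/-- Coercivity c ≤ M ((A9)/(A10)-type bound) controls the exponent: −½⟨w,Mw⟩ + ⟨w,b⟩ + s‖w‖ ≤ −(c/4)‖w‖² + (‖b‖+s)²/c (any
real s). [cite: BalabanImbrieJaffe1985, (A6) p.327] -/
theorem exponent_le {c : ℝ} (hc : 0 < c) (hcoer : ∀ w : W, c * ‖w‖ ^ 2 ≤ ⟪w, M w⟫) (s : ℝ) (w : W) :
    -(1 / 2 : ℝ) * ⟪w, M w⟫ + ⟪w, b⟫ + s * ‖w‖ ≤ -(c / 4) * ‖w‖ ^ 2 + (‖b‖ + s) ^ 2 / c := by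
  have h1 : ⟪w, b⟫ ≤ ‖w‖ * ‖b‖ := real_inner_le_norm w b
  have h2 : ‖w‖ * (‖b‖ + s) ≤ c / 4 * ‖w‖ ^ 2 + (‖b‖ + s) ^ 2 / c := mul_le_quad hc _ _
  nlinarith [hcoer w, norm_nonneg w]

/-- Completing the square — the algebra of (A16)/(A17): for M symmetric and Mm = b,
½⟨x,Mx⟩ − ⟨x,b⟩ = ½⟨x−m,M(x−m)⟩ − ½⟨b,m⟩. [cite: BalabanImbrieJaffe1985, (A16) p.328] -/
theorem complete_square (hM : ∀ x y : W, ⟪M x, y⟫ = ⟪x, M y⟫) (m : W) (hm : M m = b) (x : W) :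
    (1 / 2 : ℝ) * ⟪x, M x⟫ - ⟪x, b⟫ = (1 / 2 : ℝ) * ⟪x - m, M (x - m)⟫ - (1 / 2 : ℝ) * ⟪b, m⟫ := by
  have h1 : ⟪m, M x⟫ = ⟪x, b⟫ := by rw [← hM, hm, real_inner_comm]
  rw [map_sub, inner_sub_left, inner_sub_right, inner_sub_right, hm, h1, ← real_inner_comm m b]
  ring

variable [FiniteDimensional ℝ W]

/-- Continuity of the Gaussian exponent −½⟨w,Mw⟩ + ⟨w,b⟩ (finite dimension). [cite: BalabanImbrieJaffe1985, (A6) p.327] -/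
theorem continuous_exponent : Continuous fun w : W => -(1 / 2 : ℝ) * ⟪w, M w⟫ + ⟪w, b⟫ := by
  have hM : Continuous M := M.continuous_of_finiteDimensional
  exact (continuous_const.mul (continuous_id.inner hM)).add (continuous_id.inner continuous_const)

variable [MeasurableSpace W] [BorelSpace W]

/-- Lebesgue integrability of exp(−a‖w‖²), a > 0, on a finite-dimensional inner product space (from Mathlib's closed form).
[cite: BalabanImbrieJaffe1985, (A6) p.327] -/
theorem integrable_exp_neg_mul_sq_norm {a : ℝ} (ha : 0 < a) :
    Integrable (fun w : W => Real.exp (-a * ‖w‖ ^ 2)) := by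
  refine Integrable.of_integral_ne_zero ?_
  rw [GaussianFourier.integral_rexp_neg_mul_sq_norm ha]
  positivity

/-- Integrability of the Gaussian weight exp(−½⟨w,Mw⟩ + ⟨w,b⟩) for a coercive M (the convergence of (A6)/(A7) *"restricted
to such a subspace"*, p. 327). [cite: BalabanImbrieJaffe1985, (A7) p.327] -/
theorem integrable_gauss {c : ℝ} (hc : 0 < c) (hcoer : ∀ w : W, c * ‖w‖ ^ 2 ≤ ⟪w, M w⟫) :
    Integrable (fun w : W => Real.exp (-(1 / 2 : ℝ) * ⟪w, M w⟫ + ⟪w, b⟫)) := by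
  have hg : Integrable (fun w : W => Real.exp ((‖b‖ + 0) ^ 2 / c) * Real.exp (-(c / 4) * ‖w‖ ^ 2)) :=
    (integrable_exp_neg_mul_sq_norm (by positivity)).const_mul _
  refine hg.mono' (continuous_exponent M b).rexp.aestronglyMeasurable (ae_of_all _ fun w => ?_)
  rw [Real.norm_eq_abs, abs_of_pos (Real.exp_pos _), ← Real.exp_add]
  refine Real.exp_le_exp.mpr ?_
  have h := exponent_le M b hc hcoer 0 w
  linarith

/-- Integrability of the first-moment integrand exp(−½⟨w,Mw⟩ + ⟨w,b⟩)·w of (A15). [cite: BalabanImbrieJaffe1985, (A15) p.328] -/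
theorem integrable_gauss_smul {c : ℝ} (hc : 0 < c) (hcoer : ∀ w : W, c * ‖w‖ ^ 2 ≤ ⟪w, M w⟫) :
    Integrable (fun w : W => Real.exp (-(1 / 2 : ℝ) * ⟪w, M w⟫ + ⟪w, b⟫) • w) := by
  have hg : Integrable (fun w : W => Real.exp ((‖b‖ + 1) ^ 2 / c) * Real.exp (-(c / 4) * ‖w‖ ^ 2)) :=
    (integrable_exp_neg_mul_sq_norm (by positivity)).const_mul _
  refine hg.mono' ((continuous_exponent M b).rexp.smul continuous_id).aestronglyMeasurable
    (ae_of_all _ fun w => ?_)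
  rw [norm_smul, Real.norm_eq_abs, abs_of_pos (Real.exp_pos _)]
  have h1 : ‖w‖ ≤ Real.exp (1 * ‖w‖) := by
    have := Real.add_one_le_exp ‖w‖
    rw [one_mul]
    linarith
  calc Real.exp (-(1 / 2 : ℝ) * ⟪w, M w⟫ + ⟪w, b⟫) * ‖w‖
      ≤ Real.exp (-(1 / 2 : ℝ) * ⟪w, M w⟫ + ⟪w, b⟫) * Real.exp (1 * ‖w‖) :=
        mul_le_mul_of_nonneg_left h1 (Real.exp_pos _).le
    _ = Real.exp (-(1 / 2 : ℝ) * ⟪w, M w⟫ + ⟪w, b⟫ + 1 * ‖w‖) := (Real.exp_add _ _).symm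
    _ ≤ Real.exp ((‖b‖ + 1) ^ 2 / c) * Real.exp (-(c / 4) * ‖w‖ ^ 2) := by
        rw [← Real.exp_add]
        refine Real.exp_le_exp.mpr ?_
        have h := exponent_le M b hc hcoer 1 w
        linarith

/-- The Gaussian integral with a linear source by TRANSLATION x = y + m to the minimum ((A17) ⇒ the value of (A6)/(A7)):
∫exp(−½⟨w,Mw⟩ + ⟨w,b⟩)dw = exp(½⟨b,m⟩)·∫exp(−½⟨w,Mw⟩)dw, Mm = b (translation invariance of Lebesgue measure).
[cite: BalabanImbrieJaffe1985, (A17) p.328] -/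
theorem integral_gauss_eq (hM : ∀ x y : W, ⟪M x, y⟫ = ⟪x, M y⟫) (m : W) (hm : M m = b) :
    ∫ w : W, Real.exp (-(1 / 2 : ℝ) * ⟪w, M w⟫ + ⟪w, b⟫)
      = Real.exp ((1 / 2 : ℝ) * ⟪b, m⟫) * ∫ w : W, Real.exp (-(1 / 2 : ℝ) * ⟪w, M w⟫) := by
  have key : ∀ w : W, -(1 / 2 : ℝ) * ⟪w, M w⟫ + ⟪w, b⟫
      = (1 / 2 : ℝ) * ⟪b, m⟫ + -(1 / 2 : ℝ) * ⟪w - m, M (w - m)⟫ := by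
    intro w
    have h := complete_square M b hM m hm w
    linarith
  simp_rw [key, Real.exp_add]
  rw [integral_const_mul, integral_sub_right_eq_self (fun w : W => Real.exp (-(1 / 2 : ℝ) * ⟪w, M w⟫)) m]

/-- Z = ∫exp(−½⟨w,Mw⟩)dw > 0 (the normalisation of (A6)/(A7) is a positive number). [cite: BalabanImbrieJaffe1985, (A7) p.327] -/
theorem integral_gauss_pos {c : ℝ} (hc : 0 < c) (hcoer : ∀ w : W, c * ‖w‖ ^ 2 ≤ ⟪w, M w⟫) :
    0 < ∫ w : W, Real.exp (-(1 / 2 : ℝ) * ⟪w, M w⟫) := by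
  have h := integrable_gauss M 0 hc hcoer
  simp only [inner_zero_right, add_zero] at h
  exact integral_exp_pos h

/-- Oddness: ∫exp(−½⟨y,My⟩)·y dy = 0 (*"so the integral in (A15) equals CB"*, p. 329: the fluctuation has mean zero;
invariance of Lebesgue measure under y ↦ −y). [cite: BalabanImbrieJaffe1985, (A15) p.329] -/
theorem integral_gauss_smul_zero :
    ∫ y : W, Real.exp (-(1 / 2 : ℝ) * ⟪y, M y⟫) • y = 0 := by
  have h := integral_neg_eq_self (fun y : W => Real.exp (-(1 / 2 : ℝ) * ⟪y, M y⟫) • y) volume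
  simp only [map_neg, inner_neg_left, inner_neg_right, neg_neg, smul_neg, integral_neg] at h
  have h2 : (2 : ℝ) • ∫ y : W, Real.exp (-(1 / 2 : ℝ) * ⟪y, M y⟫) • y = 0 := by
    rw [two_smul]
    nth_rewrite 1 [← h]
    exact neg_add_cancel _
  exact (smul_eq_zero.mp h2).resolve_left two_ne_zero

/-- The Gaussian MEAN ((A15) p. 328 with (A19) p. 329): ∫exp(−½⟨w,Mw⟩ + ⟨w,b⟩)·w dw = (∫exp(−½⟨w,Mw⟩ + ⟨w,b⟩)dw)·m for
Mm = b — translation to the minimum plus oddness. [cite: BalabanImbrieJaffe1985, (A15) p.328] -/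
theorem integral_gauss_smul_eq (hM : ∀ x y : W, ⟪M x, y⟫ = ⟪x, M y⟫) {c : ℝ} (hc : 0 < c)
    (hcoer : ∀ w : W, c * ‖w‖ ^ 2 ≤ ⟪w, M w⟫) (m : W) (hm : M m = b) :
    ∫ w : W, Real.exp (-(1 / 2 : ℝ) * ⟪w, M w⟫ + ⟪w, b⟫) • w
      = (∫ w : W, Real.exp (-(1 / 2 : ℝ) * ⟪w, M w⟫ + ⟪w, b⟫)) • m := by
  haveI : CompleteSpace W := FiniteDimensional.complete ℝ W
  have hint : Integrable (fun w : W => Real.exp (-(1 / 2 : ℝ) * ⟪w, M w⟫ + ⟪w, b⟫)) :=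
    integrable_gauss M b hc hcoer
  have hint' : Integrable (fun w : W => Real.exp (-(1 / 2 : ℝ) * ⟪w, M w⟫ + ⟪w, b⟫) • w) :=
    integrable_gauss_smul M b hc hcoer
  have key : ∀ w : W, -(1 / 2 : ℝ) * ⟪w, M w⟫ + ⟪w, b⟫
      = (1 / 2 : ℝ) * ⟪b, m⟫ + -(1 / 2 : ℝ) * ⟪w - m, M (w - m)⟫ := by
    intro w
    have h := complete_square M b hM m hm w
    linarith
  -- the fluctuation w − m has mean zero: translate w = y + m, then oddness
  have hfluct : ∫ w : W, Real.exp (-(1 / 2 : ℝ) * ⟪w, M w⟫ + ⟪w, b⟫) • (w - m) = 0 := by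
    rw [← integral_add_right_eq_self (μ := (volume : Measure W))
      (fun w : W => Real.exp (-(1 / 2 : ℝ) * ⟪w, M w⟫ + ⟪w, b⟫) • (w - m)) m]
    simp only [add_sub_cancel_right]
    simp_rw [key, add_sub_cancel_right, Real.exp_add, mul_smul]
    rw [integral_smul, integral_gauss_smul_zero M, smul_zero]
  have hsplit : (fun w : W => Real.exp (-(1 / 2 : ℝ) * ⟪w, M w⟫ + ⟪w, b⟫) • w)
      = fun w : W => Real.exp (-(1 / 2 : ℝ) * ⟪w, M w⟫ + ⟪w, b⟫) • (w - m)
          + Real.exp (-(1 / 2 : ℝ) * ⟪w, M w⟫ + ⟪w, b⟫) • m := by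
    funext w
    rw [← smul_add, sub_add_cancel]
  have hint'' : Integrable (fun w : W => Real.exp (-(1 / 2 : ℝ) * ⟪w, M w⟫ + ⟪w, b⟫) • (w - m)) :=
    (hint'.sub (hint.smul_const m)).congr (ae_of_all _ fun w => by simp only [Pi.sub_apply, smul_sub])
  rw [hsplit, integral_add hint'' (hint.smul_const m), hfluct, zero_add, integral_smul_const]

end Gaussian

/-! ## (A5)–(A6) p. 327: the unconstrained case ℋ₀ = ℋ (V = 0), C = Δ⁻¹ -/

section A6

variable {H : Type*} [NormedAddCommGroup H] [InnerProductSpace ℝ H] [FiniteDimensional ℝ H]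
  [MeasurableSpace H] [BorelSpace H]

/-- **(A5)–(A6)** p. 327 [PDF 29], verbatim: *"We consider the Green's function C of Δ. Assuming 0 < Δ, then we have two convenient
representations for C. First C = Δ⁻¹, (A5) … Secondly, we can express C as a moment of a Gaussian measure, namely exp(½⟨B,CB⟩) =
Z⁻¹∫_ℋ exp(−½⟨x,Δx⟩ + ⟨x,B⟩)dx. (A6)"* — PROVED for Δ symmetric with c ≤ Δ, c > 0 (= "0 < Δ" in finite dimension) and C with
ΔC = I, Z = ∫_ℋ exp(−½⟨x,Δx⟩)dx. [cite: BalabanImbrieJaffe1985, (A6) p.327] -/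
theorem eqA6 (Δ C : H →ₗ[ℝ] H) (hΔ : ∀ x y : H, ⟪Δ x, y⟫ = ⟪x, Δ y⟫) {c : ℝ} (hc : 0 < c)
    (hcoer : ∀ x : H, c * ‖x‖ ^ 2 ≤ ⟪x, Δ x⟫) (hC : ∀ x, Δ (C x) = x) (B : H) :
    Real.exp ((1 / 2 : ℝ) * ⟪B, C B⟫)
      = (∫ x : H, Real.exp (-(1 / 2 : ℝ) * ⟪x, Δ x⟫))⁻¹ * ∫ x : H, Real.exp (-(1 / 2 : ℝ) * ⟪x, Δ x⟫ + ⟪x, B⟫) := by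
  rw [integral_gauss_eq Δ B hΔ (C B) (hC B), mul_left_comm, inv_mul_cancel₀ (integral_gauss_pos Δ hc hcoer).ne',
    mul_one]

end A6

/-! ## §2 The objects of (A9)–(A12): G = (Δ+V)⁻¹ and the (A12)-orthogonal projection P onto ℋ₀ = Null V -/

section Objects

variable {H : Type*} [NormedAddCommGroup H] [InnerProductSpace ℝ H]

variable (Δ V : H →ₗ[ℝ] H)

/-- TRANSCRIPT NOTE T6: (A9) *"I ≤ Δ₀ on ℋ₀"* follows from (A10) *"I ≤ Δ + V on ℋ"*, since on ℋ₀ = Null V the forms of Δ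
and Δ + V agree. [cite: BalabanImbrieJaffe1985, (A9)–(A10) p.328] -/
theorem a9_of_a10 (hA10 : ∀ x : H, ‖x‖ ^ 2 ≤ ⟪x, (Δ + V) x⟫) (x : H) (hx : V x = 0) : ‖x‖ ^ 2 ≤ ⟪x, Δ x⟫ := by
  have h := hA10 x
  rwa [LinearMap.add_apply, hx, add_zero] at h

/-- (A10) ⇒ Δ + V is injective, so G = (Δ+V)⁻¹ of (A11) exists. [cite: BalabanImbrieJaffe1985, (A11) p.328] -/
theorem injective_of_a10 (hA10 : ∀ x : H, ‖x‖ ^ 2 ≤ ⟪x, (Δ + V) x⟫) : Function.Injective (Δ + V) := by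
  rw [← LinearMap.ker_eq_bot, LinearMap.ker_eq_bot']
  intro x hx
  have h := hA10 x
  rw [hx, inner_zero_right] at h
  have h0 : ‖x‖ ^ 2 = 0 := le_antisymm h (sq_nonneg _)
  exact norm_eq_zero.mp (pow_eq_zero_iff two_ne_zero |>.mp h0)

/-- **(A11)** p. 328: G = (Δ+V)⁻¹ EXISTS under (A10) (finite dimension), with (Δ+V)G = I = G(Δ+V).
[cite: BalabanImbrieJaffe1985, (A11) p.328] -/
theorem exists_G [FiniteDimensional ℝ H] (hA10 : ∀ x : H, ‖x‖ ^ 2 ≤ ⟪x, (Δ + V) x⟫) :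
    ∃ G : H →ₗ[ℝ] H, (∀ x, (Δ + V) (G x) = x) ∧ ∀ x, G ((Δ + V) x) = x := by
  refine ⟨((LinearEquiv.ofInjectiveEndo (Δ + V) (injective_of_a10 Δ V hA10)).symm : H →ₗ[ℝ] H),
    fun x => ?_, fun x => ?_⟩
  · rw [LinearEquiv.coe_coe]
    have h := (LinearEquiv.ofInjectiveEndo (Δ + V) (injective_of_a10 Δ V hA10)).apply_symm_apply x
    rwa [LinearEquiv.coe_ofInjectiveEndo] at h
  · rw [LinearEquiv.coe_coe]
    have h := (LinearEquiv.ofInjectiveEndo (Δ + V) (injective_of_a10 Δ V hA10)).symm_apply_apply x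
    rwa [LinearEquiv.coe_ofInjectiveEndo] at h

/-- A right inverse of Δ + V is a two-sided inverse (finite dimension): (Δ+V)G = I ⇒ G(Δ+V) = I.
[cite: BalabanImbrieJaffe1985, (A11) p.328] -/
theorem G_left_inv (hA10 : ∀ x : H, ‖x‖ ^ 2 ≤ ⟪x, (Δ + V) x⟫) (G : H →ₗ[ℝ] H) (hG : ∀ x, (Δ + V) (G x) = x)
    (x : H) : G ((Δ + V) x) = x := by
  apply injective_of_a10 Δ V hA10
  rw [hG]

variable {Δ V}

/-- The defining property of P (p. 328: *"P denote the projection of ℋ onto ℋ₀, where P is orthogonal in the inner product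
(A12)"*) forces P = I on ℋ₀, given (A9). [cite: BalabanImbrieJaffe1985, (A12) p.328] -/
theorem P_apply_of_mem (hA9 : ∀ x : H, V x = 0 → ‖x‖ ^ 2 ≤ ⟪x, Δ x⟫) (P : H →ₗ[ℝ] H) (hP0 : ∀ x, V (P x) = 0)
    (hP : ∀ x y : H, V y = 0 → ⟪x - P x, (Δ + V) y⟫ = 0) (x : H) (hx : V x = 0) : P x = x := by
  have hy : V (x - P x) = 0 := by rw [map_sub, hx, hP0, sub_zero]
  have h := hP x (x - P x) hy
  rw [LinearMap.add_apply, hy, add_zero] at h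
  have h2 := hA9 (x - P x) hy
  rw [h] at h2
  have h0 : ‖x - P x‖ ^ 2 = 0 := le_antisymm h2 (sq_nonneg _)
  exact (sub_eq_zero.mp (norm_eq_zero.mp (pow_eq_zero_iff two_ne_zero |>.mp h0))).symm

/-- P is idempotent. [cite: BalabanImbrieJaffe1985, (A12) p.328] -/
theorem P_idem (hA9 : ∀ x : H, V x = 0 → ‖x‖ ^ 2 ≤ ⟪x, Δ x⟫) (P : H →ₗ[ℝ] H) (hP0 : ∀ x, V (P x) = 0)
    (hP : ∀ x y : H, V y = 0 → ⟪x - P x, (Δ + V) y⟫ = 0) (x : H) : P (P x) = P x :=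
  P_apply_of_mem hA9 P hP0 hP (P x) (hP0 x)

/-- UNIQUENESS of the (A12)-orthogonal projection onto ℋ₀: two maps with the defining property agree.
[cite: BalabanImbrieJaffe1985, (A12) p.328] -/
theorem P_unique (hA9 : ∀ x : H, V x = 0 → ‖x‖ ^ 2 ≤ ⟪x, Δ x⟫) (P P' : H →ₗ[ℝ] H) (hP0 : ∀ x, V (P x) = 0)
    (hP : ∀ x y : H, V y = 0 → ⟪x - P x, (Δ + V) y⟫ = 0) (hP0' : ∀ x, V (P' x) = 0)
    (hP' : ∀ x y : H, V y = 0 → ⟪x - P' x, (Δ + V) y⟫ = 0) : P = P' := by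
  ext x
  have hy : V (P x - P' x) = 0 := by rw [map_sub, hP0, hP0', sub_zero]
  have h1 := hP x (P x - P' x) hy
  have h2 := hP' x (P x - P' x) hy
  have h3 : ⟪P x - P' x, (Δ + V) (P x - P' x)⟫ = 0 := by
    have e : ⟪P x - P' x, (Δ + V) (P x - P' x)⟫
        = ⟪x - P' x, (Δ + V) (P x - P' x)⟫ - ⟪x - P x, (Δ + V) (P x - P' x)⟫ := by
      rw [← inner_sub_left]
      congr 1
      abel
    rw [e, h1, h2, sub_zero]
  rw [LinearMap.add_apply, hy, add_zero] at h3
  have h4 := hA9 _ hy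
  rw [h3] at h4
  have h0 : ‖P x - P' x‖ ^ 2 = 0 := le_antisymm h4 (sq_nonneg _)
  exact sub_eq_zero.mp (norm_eq_zero.mp (pow_eq_zero_iff two_ne_zero |>.mp h0))

/-- EXISTENCE of the (A12)-orthogonal projection onto ℋ₀ = Null V under (A10) and symmetry of Δ + V (finite dimension: the
compression of Δ + V to ℋ₀ is injective hence invertible, and P = ι M₀⁻¹P₀(Δ+V) with P₀ the ⟨,⟩-orthogonal projection).
[cite: BalabanImbrieJaffe1985, (A12) p.328] -/
theorem exists_P [FiniteDimensional ℝ H] (hΔ : ∀ x y : H, ⟪Δ x, y⟫ = ⟪x, Δ y⟫) (hV : ∀ x y : H, ⟪V x, y⟫ = ⟪x, V y⟫)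
    (hA10 : ∀ x : H, ‖x‖ ^ 2 ≤ ⟪x, (Δ + V) x⟫) :
    ∃ P : H →ₗ[ℝ] H, (∀ x, V (P x) = 0) ∧ ∀ x y : H, V y = 0 → ⟪x - P x, (Δ + V) y⟫ = 0 := by
  have hS : ∀ x y : H, ⟪(Δ + V) x, y⟫ = ⟪x, (Δ + V) y⟫ := fun x y => by
    simp only [LinearMap.add_apply, inner_add_left, inner_add_right, hΔ, hV]
  -- the compression M₀ = P₀(Δ+V)ι of Δ + V to ℋ₀ = Null V
  obtain ⟨M₀, hM₀⟩ : ∃ M₀ : LinearMap.ker V →ₗ[ℝ] LinearMap.ker V,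
      ∀ w w' : LinearMap.ker V, ⟪w, M₀ w'⟫ = ⟪(w : H), (Δ + V) w'⟫ :=
    ⟨((LinearMap.ker V).orthogonalProjectionOnto : H →ₗ[ℝ] LinearMap.ker V) ∘ₗ (Δ + V) ∘ₗ
        (LinearMap.ker V).subtype,
      fun w w' => by
        simp only [LinearMap.coe_comp, Function.comp_apply, Submodule.coe_subtype, ContinuousLinearMap.coe_coe,
          Submodule.inner_orthogonalProjectionOnto_eq_of_mem_left]⟩
  have hinj : Function.Injective M₀ := by
    rw [← LinearMap.ker_eq_bot, LinearMap.ker_eq_bot']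
    intro w hw
    have h := hA10 (w : H)
    rw [← hM₀ w w, hw, inner_zero_right] at h
    have h0 : ‖(w : H)‖ ^ 2 = 0 := le_antisymm h (sq_nonneg _)
    exact Subtype.ext (norm_eq_zero.mp (pow_eq_zero_iff two_ne_zero |>.mp h0))
  have hM₀s : ∀ w w' : LinearMap.ker V, ⟪M₀ w, w'⟫ = ⟪w, M₀ w'⟫ := fun w w' => by
    rw [real_inner_comm, hM₀, hM₀, ← hS, real_inner_comm]
  obtain ⟨N, hN⟩ : ∃ N : LinearMap.ker V →ₗ[ℝ] LinearMap.ker V, ∀ z, M₀ (N z) = z :=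
    ⟨((LinearEquiv.ofInjectiveEndo M₀ hinj).symm : LinearMap.ker V →ₗ[ℝ] LinearMap.ker V), fun z => by
      rw [LinearEquiv.coe_coe]
      have h := (LinearEquiv.ofInjectiveEndo M₀ hinj).apply_symm_apply z
      rwa [LinearEquiv.coe_ofInjectiveEndo] at h⟩
  refine ⟨(LinearMap.ker V).subtype ∘ₗ N ∘ₗ ((LinearMap.ker V).orthogonalProjectionOnto : H →ₗ[ℝ] LinearMap.ker V) ∘ₗ
      (Δ + V), fun x => ?_, fun x y hy => ?_⟩
  · simp only [LinearMap.coe_comp, Function.comp_apply, Submodule.coe_subtype]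
    exact LinearMap.mem_ker.mp (Subtype.coe_prop _)
  · have h1 : ⟪((N ((LinearMap.ker V).orthogonalProjectionOnto ((Δ + V) x)) : LinearMap.ker V) : H), (Δ + V) y⟫
        = ⟪(Δ + V) x, y⟫ := by
      have e1 : (Δ + V) y = (Δ + V) ((⟨y, LinearMap.mem_ker.mpr hy⟩ : LinearMap.ker V) : H) := rfl
      rw [e1, ← hM₀, ← hM₀s, hN, Submodule.inner_orthogonalProjectionOnto_eq_of_mem_right]
    simp only [LinearMap.coe_comp, Function.comp_apply, Submodule.coe_subtype, ContinuousLinearMap.coe_coe,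
      inner_sub_left]
    rw [h1, hS, sub_self]

end Objects

end Literature.MathematicalPhysics.QuantumFieldTheory.BalabanImbrieJaffe1984to88.BIJ85AppALemmas
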